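import Literature.NumberTheory.EllipticCurves.TunnellWaldspurgerSymmetricFamilyProofs
import Literature.NumberTheory.EllipticCurves.TunnellConverseEvenOfWaldspurgerProofs
import Literature.NumberTheory.EllipticCurves.CongruentNumberCurveLSeriesProofs
import Literature.NumberTheory.EllipticCurves.CongruentNumberCurveRootNumberEven
import HarnessLib

/-!
# `tunnell_converse_even` from signed symmetric families with LOCAL diagonal constants

[[cite: Tunnell1983Congruent, proof of Thm 3, p. 329 and §3, p. 330]] and
[[cite: Kohnen1985, §1, proof of Cor. 1]] — refinement of `TunnellConverseEvenOfSignedFamilies`: the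
diagonal hypothesis may carry a `D`-DEPENDENT non-zero constant, `R(D, D) = κ(D) L(E_{2D}, 1) √D`
with `κ(D) ≠ 0`.  The symmetric-family algebra then yields `b(D)² = C₀ κ(D) L(E_{2D}, 1) √D`
with `C₀ κ(D) ≠ 0` (`sq_eq_of_symmetricFamily_local`), which is all that the converse of
Tunnell's theorem needs: `b(d) = 0 ⇒ L(E_{2d}, 1) = 0` (`entireLFunction_one_eq_zero_of_b_eq_zero_local`,
classes `3, 7` by the root number) ⇒ `tunnell_converse_even_of_propto_local` ⇒
**`tunnell_converse_even_of_signedFamilies_local`**.  (In the Shintani-lift route `κ(D)` is a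
fixed constant times the unit `τ(χ_{2D})/√(8D)`, so the SIGN of the quadratic Gauss sum is not
needed.)

No named facts, no new definitions.
-/

noncomputable section

open UpperHalfPlane hiding I
open Complex
open scoped NumberTheorySymbols

namespace Literature.NumberTheory.EllipticCurves.Tunnell1983

open Literature.NumberTheory.EllipticCurves.ModularForms
open Literature.NumberTheory.EllipticCurves

/-- **The symmetric-family lemma with a `D`-dependent non-zero diagonal constant**: as
`sq_eq_of_symmetricFamily`, but (H3) reads `R(D, D) = κ(D) Lv(D) √D` with `κ(D) ≠ 0` for every
`D` in the class; the conclusion becomes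
`c(D)² = c(D₀)² (κ(D₀) Lv(D₀) √D₀)⁻¹ · κ(D) · Lv(D) √D` (so the proportionality constant may
depend on `D`, but is explicit and non-zero when `c(D₀) ≠ 0`).  This is the shape delivered when
the Gauss sum `τ(χ_{2D})` is known only up to a unit.
[cite: Tunnell1983Congruent, proof of Thm 3, p. 329] [cite: Kohnen1985, §1, proof of Cor. 1] -/
theorem sq_eq_of_symmetricFamily_local {r D₀ : ℕ} (R : ℕ → ℕ → ℂ) (c Lv : ℕ → ℂ) (guard : ℕ → Prop)
    (κ : ℕ → ℂ) (hκ : ∀ D, κ D ≠ 0) (hD₀ : Squarefree D₀) (hD₀r : D₀ % 8 = r) (hg₀ : guard D₀)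
    (hL₀ : Lv D₀ ≠ 0)
    (hA : ∀ ⦃D : ℕ⦄, Squarefree D → D % 8 = r → ∃ A : ℂ, ∀ ⦃m : ℕ⦄, m % 8 = r → R D m = A * c m)
    (hsymm : ∀ ⦃D : ℕ⦄, Squarefree D → D % 8 = r → R D D₀ = R D₀ D)
    (hdiag : ∀ ⦃D : ℕ⦄, Squarefree D → D % 8 = r → guard D →
      R D D = κ D * Lv D * (Real.sqrt D : ℂ))
    ⦃D : ℕ⦄ (hD : Squarefree D) (hDr : D % 8 = r) (hgD : guard D) :
    c D ^ 2 = c D₀ ^ 2 * (κ D₀ * Lv D₀ * (Real.sqrt D₀ : ℂ))⁻¹ * κ D * Lv D * (Real.sqrt D : ℂ) := by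
  obtain ⟨A₀, hA₀⟩ := hA hD₀ hD₀r
  obtain ⟨A, hAD⟩ := hA hD hDr
  have e1 : A * c D₀ = A₀ * c D := by
    rw [← hA₀ hDr, ← hAD hD₀r]
    exact hsymm hD hDr
  have e2 : A * c D = κ D * Lv D * (Real.sqrt D : ℂ) := by
    rw [← hAD hDr]; exact hdiag hD hDr hgD
  have e3 : A₀ * c D₀ = κ D₀ * Lv D₀ * (Real.sqrt D₀ : ℂ) := by
    rw [← hA₀ hD₀r]; exact hdiag hD₀ hD₀r hg₀
  have hs₀ : (Real.sqrt D₀ : ℂ) ≠ 0 := by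
    have h0 : (0 : ℝ) < D₀ := by exact_mod_cast Nat.pos_of_ne_zero hD₀.ne_zero
    exact Complex.ofReal_ne_zero.2 (Real.sqrt_pos.2 h0).ne'
  have hne : κ D₀ * Lv D₀ * (Real.sqrt D₀ : ℂ) ≠ 0 := mul_ne_zero (mul_ne_zero (hκ D₀) hL₀) hs₀
  -- `κ₀L₀s₀ · c(D)² = A₀ c(D₀) c(D)² = A c(D₀)·c(D₀) c(D) = c(D₀)²·A c(D) = c(D₀)² κ_D L_D s_D`
  have key : (κ D₀ * Lv D₀ * (Real.sqrt D₀ : ℂ)) * c D ^ 2 = c D₀ ^ 2 * (κ D * Lv D * (Real.sqrt D : ℂ)) := by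
    linear_combination (-(c D ^ 2)) * e3 - (c D₀ * c D) * e1 + (c D₀ ^ 2) * e2
  have hk0 := hκ D₀
  rw [mul_inv, mul_inv]
  field_simp
  linear_combination key

/-- **`L(E_{2d}, 1) = 0` from `b(d) = 0` with LOCAL constants**: if for every square-free `d` in the
classes `1, 5 (mod 8)` there is `c_d ≠ 0` with `b(d)² = c_d L(E_{2d}, 1) √d`, then `b(d) = 0`
forces `L(E_{2d}, 1) = 0`; on the classes `3, 7` the `L`-value vanishes by the root number.
[cite: Tunnell1983Congruent, §3, p. 330] -/
theorem entireLFunction_one_eq_zero_of_b_eq_zero_local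
    (h : ∀ ⦃d : ℕ⦄, Squarefree d → (d % 8 = 1 ∨ d % 8 = 5) →
      (congruentNumberCurve (2 * d)).HasEntireLFunction →
      ∃ c : ℂ, c ≠ 0 ∧ (b d : ℂ) ^ 2 = c * (congruentNumberCurve (2 * d)).entireLFunction 1 * (Real.sqrt d : ℂ))
    {d : ℕ} (hd : Squarefree (2 * d)) (hb : b d = 0) :
    (congruentNumberCurve (2 * d)).entireLFunction 1 = 0 := by
  have hodd : Odd d := odd_of_squarefree_two_mul hd
  have hd' : Squarefree d := hd.of_mul_right
  have hLd : (congruentNumberCurve (2 * d)).HasEntireLFunction := hasEntireLFunction_congruentNumberCurve_holds hd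
  have hd0 : (0 : ℝ) < d := by exact_mod_cast Nat.pos_of_ne_zero hd'.ne_zero
  have hsd : (Real.sqrt d : ℂ) ≠ 0 := Complex.ofReal_ne_zero.2 (Real.sqrt_pos.2 hd0).ne'
  have hbd : ((b d : ℚ) : ℂ) = 0 := by rw [hb, Rat.cast_zero]
  rcases mod_eight_of_odd hodd with h8 | h8 | h8 | h8
  · obtain ⟨c, hc, e⟩ := h hd' (Or.inl h8) hLd
    rw [hbd] at e
    exact eq_zero_of_sq_zero_eq_mul e hc hsd
  · exact entireLFunction_congruentNumberCurve_one_eq_zero_of_mod_eight_eq_six hd (by omega)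
  · obtain ⟨c, hc, e⟩ := h hd' (Or.inr h8) hLd
    rw [hbd] at e
    exact eq_zero_of_sq_zero_eq_mul e hc hsd
  · exact entireLFunction_congruentNumberCurve_one_eq_zero_of_mod_eight_eq_six hd (by omega)

/-- **`tunnell_converse_even` from the local proportionality.** [cite: KoblitzECMF1993, Ch. IV §4] -/
theorem tunnell_converse_even_of_propto_local
    (h : ∀ ⦃d : ℕ⦄, Squarefree d → (d % 8 = 1 ∨ d % 8 = 5) →
      (congruentNumberCurve (2 * d)).HasEntireLFunction →
      ∃ c : ℂ, c ≠ 0 ∧ (b d : ℂ) ^ 2 = c * (congruentNumberCurve (2 * d)).entireLFunction 1 * (Real.sqrt d : ℂ)) :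
    tunnell_converse_even := by
  intro n hn heven hBSD hcount
  obtain ⟨d, rfl⟩ := heven.two_dvd
  exact isCongruentNumber_of_entireLFunction_one_eq_zero hn.ne_zero
    (hasEntireLFunction_congruentNumberCurve_holds hn)
    (entireLFunction_one_eq_zero_of_b_eq_zero_local h hn ((b_eq_zero_iff d).2 hcount)) hBSD

/-- **`tunnell_converse_even` from two signed symmetric families with local diagonal constants**
(`κ_r D ≠ 0` possibly depending on `D`): the final shape of the level-`256` Shintani-lift route.
[cite: Tunnell1983Congruent, proof of Thm 3, p. 329] [cite: KoblitzECMF1993, Ch. IV §4] -/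
theorem tunnell_converse_even_of_signedFamilies_local (R₁ R₅ : ℕ → ℕ → ℂ) (s : ℕ → ℂ)
    (hs : ∀ m : ℕ, s m ^ 2 = 1) (κ₁ κ₅ : ℕ → ℂ) (hκ₁ : ∀ D, κ₁ D ≠ 0) (hκ₅ : ∀ D, κ₅ D ≠ 0)
    (hA₁ : ∀ ⦃D : ℕ⦄, Squarefree D → D % 8 = 1 →
      ∃ A : ℂ, ∀ ⦃m : ℕ⦄, m % 8 = 1 → R₁ D m = A * (s m * (b m : ℂ)))
    (hsymm₁ : ∀ ⦃D : ℕ⦄, Squarefree D → D % 8 = 1 → R₁ D 1 = R₁ 1 D)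
    (hdiag₁ : ∀ ⦃D : ℕ⦄, Squarefree D → D % 8 = 1 →
      (congruentNumberCurve (2 * D)).HasEntireLFunction →
      R₁ D D = κ₁ D * (congruentNumberCurve (2 * D)).entireLFunction 1 * (Real.sqrt D : ℂ))
    (hA₅ : ∀ ⦃D : ℕ⦄, Squarefree D → D % 8 = 5 →
      ∃ A : ℂ, ∀ ⦃m : ℕ⦄, m % 8 = 5 → R₅ D m = A * (s m * (b m : ℂ)))
    (hsymm₅ : ∀ ⦃D : ℕ⦄, Squarefree D → D % 8 = 5 → R₅ D 5 = R₅ 5 D)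
    (hdiag₅ : ∀ ⦃D : ℕ⦄, Squarefree D → D % 8 = 5 →
      (congruentNumberCurve (2 * D)).HasEntireLFunction →
      R₅ D D = κ₅ D * (congruentNumberCurve (2 * D)).entireLFunction 1 * (Real.sqrt D : ℂ)) :
    tunnell_converse_even := by
  have hL := @hasEntireLFunction_congruentNumberCurve_holds
  have h5 : Squarefree 5 := (Nat.prime_five).prime.squarefree
  have hsq : ∀ D : ℕ, (s D * (b D : ℂ)) ^ 2 = (b D : ℂ) ^ 2 := fun D ↦ by rw [mul_pow, hs, one_mul]
  have hb1 : (s 1 * (b 1 : ℂ)) ^ 2 = 1 := by rw [hsq, b_one]; norm_num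
  have hb5 : (s 5 * (b 5 : ℂ)) ^ 2 ≠ 0 := by rw [hsq, b_five]; norm_num
  have key : ∀ ⦃d : ℕ⦄, Squarefree d → (d % 8 = 1 ∨ d % 8 = 5) →
      (congruentNumberCurve (2 * d)).HasEntireLFunction →
      ∃ c : ℂ, c ≠ 0 ∧ (b d : ℂ) ^ 2 = c * (congruentNumberCurve (2 * d)).entireLFunction 1 * (Real.sqrt d : ℂ) := by
    intro d hd hclass hLd
    rcases hclass with h1 | h5'
    · refine ⟨(s 1 * (b 1 : ℂ)) ^ 2 * (κ₁ 1 * (congruentNumberCurve (2 * 1)).entireLFunction 1 * (Real.sqrt (1 : ℕ) : ℂ))⁻¹ * κ₁ d, ?_, ?_⟩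
      · refine mul_ne_zero (mul_ne_zero (by rw [hb1]; exact one_ne_zero) (inv_ne_zero ?_)) (hκ₁ d)
        refine mul_ne_zero (mul_ne_zero (hκ₁ 1) ?_) (by simp)
        simpa using entireLFunction_congruentNumberCurve_two_one_ne_zero
      · rw [← hsq]
        have := sq_eq_of_symmetricFamily_local R₁ (fun m ↦ s m * (b m : ℂ))
          (fun D ↦ (congruentNumberCurve (2 * D)).entireLFunction 1)
          (fun D ↦ (congruentNumberCurve (2 * D)).HasEntireLFunction) κ₁ hκ₁ squarefree_one rfl
          (hL (squarefree_two_mul_of_odd squarefree_one odd_one))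
          (by simpa using entireLFunction_congruentNumberCurve_two_one_ne_zero) hA₁ hsymm₁ hdiag₁ hd h1 hLd
        rw [this]
    · refine ⟨(s 5 * (b 5 : ℂ)) ^ 2 * (κ₅ 5 * (congruentNumberCurve (2 * 5)).entireLFunction 1 * (Real.sqrt (5 : ℕ) : ℂ))⁻¹ * κ₅ d, ?_, ?_⟩
      · refine mul_ne_zero (mul_ne_zero hb5 (inv_ne_zero ?_)) (hκ₅ d)
        refine mul_ne_zero (mul_ne_zero (hκ₅ 5) ?_) ?_
        · simpa using entireLFunction_congruentNumberCurve_ten_one_ne_zero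
        · exact Complex.ofReal_ne_zero.2 (by positivity)
      · rw [← hsq]
        have := sq_eq_of_symmetricFamily_local R₅ (fun m ↦ s m * (b m : ℂ))
          (fun D ↦ (congruentNumberCurve (2 * D)).entireLFunction 1)
          (fun D ↦ (congruentNumberCurve (2 * D)).HasEntireLFunction) κ₅ hκ₅ h5 rfl
          (hL (squarefree_two_mul_of_odd h5 (by decide)))
          (by simpa using entireLFunction_congruentNumberCurve_ten_one_ne_zero) hA₅ hsymm₅ hdiag₅ hd h5' hLd
        rw [this]
  intro n hn heven hBSD hcount
  exact tunnell_converse_even_of_propto_local key hn heven hBSD hcount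

end Literature.NumberTheory.EllipticCurves.Tunnell1983
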